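import Mathlib
import HarnessLib

/-!
# Automorphisms of `𝔰𝔩ₙ`, IV: the automorphisms of the root system `A_{n−1}` in combinatorial form
# (Humphreys §12.2: `Aut Φ(A_l) = W(A_l) ⋊ {±1}`, i.e. `S_n × {±1}` acting on the roots `ε_i − ε_j`)

Topic `Algebra/Lie`. Cell `hodge-nonav`, route `Summits/HodgeConjecture/HodgeConjecture/Theses/CyclicUnitaryPowers.lean`, crux K1
`VeryGeneralDeckCommutatorsInHg` (stmt-HodgeConjecture-19544): step **C5** of the roadmap
`HOME/memos/GKR-CORE-ROADMAP-Ax-g2.md` towards discharging the named fact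
`Literature.AlgebraicGeometry.HodgeTheory.Katz1990_goursatKolchinRibet_specialLinear'` (Goursat–Kolchin–Ribet) — the
classification of the automorphisms of `𝔰𝔩ₙ` is the one piece of that roadmap which is new mathematics for the tree.
The series has five parts: `SpecialLinearAdSemisimple`, `SpecialLinearToralNormalisation`,
`SpecialLinearRootTransport`, `SpecialLinearRootCombinatorics`, `SpecialLinearAutomorphisms` (main theorem).
Everything is PROVED (0 `sorry`, no new definition, no named fact); `𝔰𝔩ₙ` is Mathlib's
`LieAlgebra.SpecialLinear.sl n K` with the commutator bracket (Mathlib's local instance `LieRing.ofAssociativeRing`,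
as in `Literature.Algebra.Lie.SpecialLinearSimple`).

This part is pure finite combinatorics (Mathlib only): `exists_perm_of_pairMap` — a map of ordered pairs of distinct
indices `(i, j) ↦ (κ₁ i j, κ₂ i j)` which is injective, compatible with reversal `(j, i) ↦ (κ₂ i j, κ₁ i j)`, and such
that the images of `(i, j)` and `(i, k)` always share their first or their second coordinate, is `(i, j) ↦ (σ i, σ j)`
for all pairs, or `(i, j) ↦ (σ j, σ i)` for all pairs, with `σ` injective.  (For `|n| = 2` the first alternative
always holds; for `|n| ≥ 3` every index is «first-oriented» or «second-oriented», the orientation is constant, and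
`σ` is read off.)  This is the statement that an additive bijection of the root system `{ε_i − ε_j}` is induced by a
permutation of the indices, possibly composed with `−1`.

## References

* [Humphreys1972] J. E. Humphreys, *Introduction to Lie Algebras and Representation Theory*, GTM 9, §12.2 (Table 1:
  `Aut Φ / W = ℤ/2` for `A_l`, `l ≥ 2`; trivial for `A_1`).
* [Jacobson1962LieAlgebras] N. Jacobson, *Lie Algebras*, Ch. IX §5 Theorem 5.
-/

namespace Literature.Algebra.Lie.SpecialLinearAutomorphisms

variable {n : Type*}

section Combinatorics

variable {κ₁ κ₂ : n → n → n}

/-- **Automorphisms of the root system `A_{n−1}` (combinatorial form).** A map of ordered pairs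
`(i, j) ↦ (κ₁ i j, κ₂ i j)` (`i ≠ j`) into ordered pairs of distinct indices which is injective, compatible
with reversal, and such that the images of `(i, j)` and `(i, k)` always share their first or their second
index, is of the form `(i, j) ↦ (σ i, σ j)` or `(i, j) ↦ (σ j, σ i)` for an injective `σ`.
[cite: Humphreys1972, §12.2 Table 1] -/
theorem exists_perm_of_pairMap [Finite n] (hn : ∃ p q : n, p ≠ q)
    (hne : ∀ i j, i ≠ j → κ₁ i j ≠ κ₂ i j)
    (hinj : ∀ i j i' j', i ≠ j → i' ≠ j' → κ₁ i j = κ₁ i' j' → κ₂ i j = κ₂ i' j' → i = i' ∧ j = j')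
    (hrev : ∀ i j, i ≠ j → κ₁ j i = κ₂ i j ∧ κ₂ j i = κ₁ i j)
    (hshare : ∀ i j k, i ≠ j → i ≠ k → j ≠ k → κ₁ i j = κ₁ i k ∨ κ₂ i j = κ₂ i k) :
    ∃ σ : n → n, Function.Injective σ ∧
      ((∀ i j, i ≠ j → κ₁ i j = σ i ∧ κ₂ i j = σ j) ∨ (∀ i j, i ≠ j → κ₁ i j = σ j ∧ κ₂ i j = σ i)) := by
  classical
  -- every index has another one
  have hother : ∀ i : n, ∃ j, j ≠ i := by
    intro i
    obtain ⟨p, q, hpq⟩ := hn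
    by_cases hp : p = i
    · exact ⟨q, fun h => hpq (hp.trans h.symm)⟩
    · exact ⟨p, hp⟩
  choose other hother using hother
  -- orientations
  let F : n → Prop := fun i => ∀ j k, j ≠ i → k ≠ i → κ₁ i j = κ₁ i k
  let S : n → Prop := fun i => ∀ j k, j ≠ i → k ≠ i → κ₂ i j = κ₂ i k
  -- Step 3: conclusion from a constant orientation
  have step3 : (∀ i, F i) ∨ (∀ i, S i) → ∃ σ : n → n, Function.Injective σ ∧
      ((∀ i j, i ≠ j → κ₁ i j = σ i ∧ κ₂ i j = σ j) ∨ (∀ i j, i ≠ j → κ₁ i j = σ j ∧ κ₂ i j = σ i)) := by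
    rintro (hF | hS)
    · refine ⟨fun i => κ₁ i (other i), ?_, Or.inl ?_⟩
      · intro i j hij
        by_contra h
        have h1 : κ₁ i j = κ₁ i (other i) := hF i j (other i) (Ne.symm h) (hother i)
        have h2 : κ₂ i j = κ₁ j (other j) := ((hrev i j h).1.symm).trans (hF j i (other j) h (hother j))
        exact hne i j h (h1.trans (hij.trans h2.symm))
      · intro i j hij
        exact ⟨hF i j (other i) (Ne.symm hij) (hother i),
          ((hrev i j hij).1.symm).trans (hF j i (other j) hij (hother j))⟩
    · refine ⟨fun i => κ₂ i (other i), ?_, Or.inr ?_⟩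
      · intro i j hij
        by_contra h
        have h1 : κ₂ i j = κ₂ i (other i) := hS i j (other i) (Ne.symm h) (hother i)
        have h2 : κ₁ i j = κ₂ j (other j) := ((hrev i j h).2.symm).trans (hS j i (other j) h (hother j))
        exact hne i j h (h2.trans (hij.symm.trans h1.symm))
      · intro i j hij
        exact ⟨((hrev i j hij).2.symm).trans (hS j i (other j) hij (hother j)),
          hS i j (other i) (Ne.symm hij) (hother i)⟩
  apply step3
  by_cases h3 : ∃ a b c : n, a ≠ b ∧ a ≠ c ∧ b ≠ c
  swap
  · -- two indices only: `F` holds vacuously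
    left
    intro i j k hj hk
    have hjk : j = k := by
      by_contra hjk
      exact h3 ⟨i, j, k, Ne.symm hj, Ne.symm hk, hjk⟩
    rw [hjk]
  -- at least three indices
  -- exclusivity of the sharing alternative
  have hexcl : ∀ i j k, i ≠ j → i ≠ k → j ≠ k → ¬(κ₁ i j = κ₁ i k ∧ κ₂ i j = κ₂ i k) := by
    intro i j k hij hik hjk h
    exact hjk (hinj i j i k hij hik h.1 h.2).2
  -- Step 1: each index is oriented
  have step1 : ∀ i, F i ∨ S i := by
    intro i
    by_cases hFi : F i
    · exact Or.inl hFi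
    right
    simp only [F, not_forall] at hFi
    obtain ⟨j₀, k₀, hj₀, hk₀, hne₀⟩ := hFi
    have hj₀k₀ : j₀ ≠ k₀ := fun h => hne₀ (by rw [h])
    have hs₀ : κ₂ i j₀ = κ₂ i k₀ :=
      (hshare i j₀ k₀ (Ne.symm hj₀) (Ne.symm hk₀) hj₀k₀).resolve_left hne₀
    -- every `κ₂ i j` equals `κ₂ i j₀`
    have hall : ∀ j, j ≠ i → κ₂ i j = κ₂ i j₀ := by
      intro j hj
      by_cases h1 : j = j₀
      · rw [h1]
      by_cases h2 : j = k₀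
      · rw [h2, hs₀]
      rcases hshare i j j₀ (Ne.symm hj) (Ne.symm hj₀) h1 with h | h
      · rcases hshare i j k₀ (Ne.symm hj) (Ne.symm hk₀) h2 with h' | h'
        · exact absurd (h.symm.trans h') hne₀
        · exact h'.trans hs₀.symm
      · exact h
    intro j k hj hk
    rw [hall j hj, hall k hk]
  -- Step 2: the orientation is constant
  have hFS : ∀ i, ¬(F i ∧ S i) := by
    intro i ⟨hF, hS⟩
    obtain ⟨a, b, c, hab, hac, hbc⟩ := h3
    -- two indices distinct from `i`
    obtain ⟨j, k, hj, hk, hjk⟩ : ∃ j k, j ≠ i ∧ k ≠ i ∧ j ≠ k := by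
      by_cases hai : a = i
      · exact ⟨b, c, fun h => hab (hai.trans h.symm), fun h => hac (hai.trans h.symm), hbc⟩
      by_cases hbi : b = i
      · exact ⟨a, c, hai, fun h => hbc (hbi.trans h.symm), hac⟩
      · exact ⟨a, b, hai, hbi, hab⟩
    exact hexcl i j k (Ne.symm hj) (Ne.symm hk) hjk ⟨hF j k hj hk, hS j k hj hk⟩
  have step2 : ∀ i i', F i → S i' → False := by
    intro i i' hF hS
    have hii' : i ≠ i' := fun h => hFS i ⟨hF, h ▸ hS⟩
    obtain ⟨a, b, c, hab, hac, hbc⟩ := h3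
    -- an index distinct from `i` and `i'`
    obtain ⟨k, hki, hki'⟩ : ∃ k, k ≠ i ∧ k ≠ i' := by
      by_cases hai : a = i
      · by_cases hbi' : b = i'
        · exact ⟨c, fun h => hac (hai.trans h.symm), fun h => hbc (hbi'.trans h.symm)⟩
        · exact ⟨b, fun h => hab (hai.trans h.symm), hbi'⟩
      · by_cases hai' : a = i'
        · by_cases hbi : b = i
          · exact ⟨c, fun h => hbc (hbi.trans h.symm), fun h => hac (hai'.trans h.symm)⟩
          · exact ⟨b, hbi, fun h => hab (hai'.trans h.symm)⟩
        · exact ⟨a, hai, hai'⟩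
    -- `κ(i,i') = (x, y)`; all first indices at `i` are `x`, all second indices at `i'` are `x`
    have e1 : κ₁ i k = κ₁ i i' := hF k i' hki (Ne.symm hii')
    have e2 : κ₂ i' k = κ₂ i' i := hS k i hki' hii'
    have e3 : κ₂ i' i = κ₁ i i' := (hrev i i' hii').2
    rcases step1 k with hFk | hSk
    · -- `κ₁ k i = κ₂ i k`, `κ₁ k i' = κ₂ i' k = κ₁ i i' = κ₁ i k`: contradiction with `hne i k`
      have h1 : κ₁ k i = κ₁ k i' := hFk i i' (Ne.symm hki) (Ne.symm hki')
      rw [(hrev i k (Ne.symm hki)).1, (hrev i' k (Ne.symm hki')).1, e2, e3, ← e1] at h1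
      exact hne i k (Ne.symm hki) h1.symm
    · have h1 : κ₂ k i = κ₂ k i' := hSk i i' (Ne.symm hki) (Ne.symm hki')
      rw [(hrev i k (Ne.symm hki)).2, (hrev i' k (Ne.symm hki')).2, e1] at h1
      -- `h1 : κ₁ i i' = κ₁ i' k`; and `κ₂ i' k = κ₁ i i'`, contradiction with `hne i' k`
      exact hne i' k (Ne.symm hki') (h1.symm.trans (e2.trans e3).symm)
  by_cases hex : ∃ i, F i
  · obtain ⟨i₀, hi₀⟩ := hex
    left
    intro i
    rcases step1 i with h | h
    · exact h
    · exact (step2 i₀ i hi₀ h).elim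
  · right
    intro i
    rcases step1 i with h | h
    · exact (hex ⟨i, h⟩).elim
    · exact h

end Combinatorics

end Literature.Algebra.Lie.SpecialLinearAutomorphisms
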